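import Summits.Ventures.PercRepro.Night2SeriesTriangle

/-!
# PercRepro — the SERIES-CLASS count for a class of four points (night-2, gen 23)

If every pair of a 4-set `Q₄ = {p, x, y, z} ⊆ G` is a 2-cocircuit (the six sets `G ∖ {a, b}` have rank `≤ q` and
contain `K`), every covering basis contains all but at most one point of `Q₄` (a basis missing two of them would lie
inside the rank-`≤ q` set `G ∖ {a, b}`).  Hence the covering bases of a target number at most

  `cntK4 ρ s = 4·C(s − 4, ρ − 3) + C(s − 4, ρ − 4)`

(`card_coverBases_le_cntK4`): the bases containing exactly `Q₄ ∖ {v}` inject into the `(ρ − 3)`-subsets of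
`S′ ∖ Q₄`, those containing `Q₄` into the `(ρ − 4)`-subsets; when a point of `Q₄` is outside the target only one of
the five families is nonempty and `C(s − 3, ρ − 3) ≤ cntK4 ρ s`.  With the chord of gen 20 the count sum at `(3, 0)` is
`1.137` at `n = 11` and `1.263` at `n = 12` (a `K₄` series class arises from a triangle and a fourth fat pair meeting
it in one point, by series transitivity twice).
-/

namespace PercRepro.Shadow

open Finset PerFlat ThmH

/-- The `K₄` class count `4·C(s − 4, ρ − 3) + C(s − 4, ρ − 4)`. -/
noncomputable def cntK4 (ρ s : ℕ) : ℚ :=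
  4 * ((s - 4).choose (ρ - 3) : ℚ) + ((s - 4).choose (ρ - 4) : ℚ)

/-- `cntK4 6 s > 0` for `7 ≤ s ≤ 12`. -/
theorem cntK4_six_pos : ∀ s, 7 ≤ s → s ≤ 12 → 0 < cntK4 6 s := by
  intro s h1 h2
  unfold cntK4
  interval_cases s <;> norm_num [Nat.choose_eq_descFactorial_div_factorial, Nat.descFactorial, Nat.factorial]

variable {α : Type*} [DecidableEq α]

/-- The `ρ`-subsets of `X` containing a fixed `A ⊆ X` (and nothing else prescribed) number `C(|X ∖ A|, ρ − |A|)`: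
they inject into the `(ρ − |A|)`-subsets of `X ∖ A` by `T ↦ T ∖ A`. -/
theorem card_filter_subset_le (X A : Finset α) (ρ : ℕ) :
    ((X.powersetCard ρ).filter (fun T => A ⊆ T)).card ≤ (X \ A).card.choose (ρ - A.card) := by
  rw [← Finset.card_powersetCard]
  apply Finset.card_le_card_of_injOn (fun T => T \ A)
  · intro T hT
    rw [Finset.mem_coe, Finset.mem_filter, Finset.mem_powersetCard] at hT
    rw [Finset.mem_coe, Finset.mem_powersetCard]
    refine ⟨Finset.sdiff_subset_sdiff hT.1.1 le_rfl, ?_⟩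
    rw [Finset.card_sdiff_of_subset hT.2, hT.1.2]
  · intro T hT T' hT' heq
    rw [Finset.mem_coe, Finset.mem_filter] at hT hT'
    simp only at heq
    calc T = T \ A ∪ A := (Finset.sdiff_union_of_subset hT.2).symm
      _ = T' \ A ∪ A := by rw [heq]
      _ = T' := Finset.sdiff_union_of_subset hT'.2

variable {M : Matroid α} [M.Finite]

open scoped Classical in
/-- **The `K₄` class count**: if the six sets `G ∖ {a, b}` (`a ≠ b` in `Q₄ = {p, x, y, z}`, four distinct points of `G`)
have rank `≤ q` and contain `K`, then `#coverBases(S) ≤ cntK4 ρ |S ∖ K|` for every target `S ⊆ G` (`ρ ≥ 4`; the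
points need not even lie in `G`). -/
theorem card_coverBases_le_cntK4 {q ρ : ℕ} {G : Finset α} (hk : kColoops M G + ρ = q + 1) (hρ : 4 ≤ ρ)
    {p x y z : α} (hpx : p ≠ x) (hpy : p ≠ y) (hpz : p ≠ z) (hxy : x ≠ y) (hxz : x ≠ z) (hyz : y ≠ z)
    (hcoc : ∀ a ∈ ({p, x, y, z} : Finset α), ∀ b ∈ ({p, x, y, z} : Finset α), a ≠ b →
      coloops M G ⊆ G \ {a, b} ∧ M.eRk ((G \ {a, b} : Finset α) : Set α) ≤ (q : ℕ∞))
    {S : Finset α} (hSG : S ⊆ G) :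
    ((coverBases M G S ρ).card : ℚ) ≤ cntK4 ρ (S \ coloops M G).card := by
  set S' := S \ coloops M G with hS'
  have hS'G : S' ⊆ G := Finset.sdiff_subset.trans hSG
  set Q₄ : Finset α := {p, x, y, z} with hQ₄
  have hQcard : Q₄.card = 4 := by
    rw [hQ₄, Finset.card_insert_of_notMem, Finset.card_insert_of_notMem, Finset.card_pair hyz]
    · simp only [Finset.mem_insert, Finset.mem_singleton]; tauto
    · simp only [Finset.mem_insert, Finset.mem_singleton]; tauto
  -- no covering basis misses two points of the class
  have hnot : ∀ T ∈ coverBases M G S ρ, ∀ a ∈ Q₄, ∀ b ∈ Q₄, a ≠ b → a ∉ T → b ∉ T → False := by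
    intro T hT a ha b hb hab haT hbT
    obtain ⟨hKab, hHab⟩ := hcoc a ha b hb hab
    unfold coverBases at hT
    rw [Finset.mem_filter] at hT
    obtain ⟨hTp, hind⟩ := hT
    rw [Finset.mem_powersetCard] at hTp
    have hTK : Disjoint (coloops M G) T := by
      rw [Finset.disjoint_left]
      intro w hw hwT
      exact (Finset.mem_sdiff.1 (hTp.1 hwT)).2 hw
    have hcard : (coloops M G ∪ T).card = q + 1 := by
      rw [Finset.card_union_of_disjoint hTK, ← kColoops_eq_card_coloops, hTp.2, hk]
    have hKT : ((coloops M G ∪ T : Finset α) : Set α) ⊆ ((G \ {a, b} : Finset α) : Set α) := by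
      rw [Finset.coe_subset]
      apply Finset.union_subset hKab
      intro w hw
      rw [Finset.mem_sdiff]
      refine ⟨hS'G (hTp.1 hw), ?_⟩
      simp only [Finset.mem_insert, Finset.mem_singleton]
      rintro (rfl | rfl)
      · exact haT hw
      · exact hbT hw
    have h1 := hind.encard_le_eRk_of_subset hKT
    rw [Set.encard_coe_eq_coe_finsetCard, hcard] at h1
    have h2 : ((q + 1 : ℕ) : ℕ∞) ≤ (q : ℕ∞) := h1.trans hHab
    have h3 : q + 1 ≤ q := by exact_mod_cast h2
    omega
  -- the five families
  set F : α → Finset (Finset α) := fun v => (S'.powersetCard ρ).filter (fun T => Q₄.erase v ⊆ T ∧ v ∉ T) with hF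
  set F₄ : Finset (Finset α) := (S'.powersetCard ρ).filter (fun T => Q₄ ⊆ T) with hF₄
  have hcover : coverBases M G S ρ ⊆ Q₄.biUnion F ∪ F₄ := by
    intro T hT
    have hTp : T ∈ S'.powersetCard ρ := by
      unfold coverBases at hT
      exact (Finset.mem_filter.1 hT).1
    rw [Finset.mem_union, Finset.mem_biUnion]
    by_cases hall : Q₄ ⊆ T
    · exact Or.inr (Finset.mem_filter.2 ⟨hTp, hall⟩)
    · rw [Finset.not_subset] at hall
      obtain ⟨v, hvQ, hvT⟩ := hall
      refine Or.inl ⟨v, hvQ, Finset.mem_filter.2 ⟨hTp, ?_, hvT⟩⟩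
      intro w hw
      rw [Finset.mem_erase] at hw
      by_contra hwT
      exact hnot T hT v hvQ w hw.2 (Ne.symm hw.1) hvT hwT
  have hcardF : ∀ v ∈ Q₄, (F v).card ≤ ((S' \ Q₄).card).choose (ρ - 3) := by
    intro v hv
    by_cases hsub : Q₄.erase v ⊆ S'
    · have h1 : F v ⊆ (S'.powersetCard ρ).filter (fun T => Q₄.erase v ⊆ T) := by
        intro T hT
        rw [hF, Finset.mem_filter] at hT
        exact Finset.mem_filter.2 ⟨hT.1, hT.2.1⟩
      -- `T ∖ (Q₄ ∖ v) = T ∖ Q₄` for `v ∉ T`: inject into the `(ρ − 3)`-subsets of `S′ ∖ Q₄`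
      have h2 : (F v).card ≤ ((S' \ Q₄).powersetCard (ρ - 3)).card := by
        apply Finset.card_le_card_of_injOn (fun T => T \ Q₄)
        · intro T hT
          rw [Finset.mem_coe, hF, Finset.mem_filter, Finset.mem_powersetCard] at hT
          rw [Finset.mem_coe, Finset.mem_powersetCard]
          refine ⟨Finset.sdiff_subset_sdiff hT.1.1 le_rfl, ?_⟩
          have hTQ : T ∩ Q₄ = Q₄.erase v := by
            ext w
            simp only [Finset.mem_inter, Finset.mem_erase]
            constructor
            · rintro ⟨hwT, hwQ⟩
              refine ⟨fun h => hT.2.2 (h ▸ hwT), hwQ⟩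
            · rintro ⟨hwv, hwQ⟩
              exact ⟨hT.2.1 (Finset.mem_erase.2 ⟨hwv, hwQ⟩), hwQ⟩
          have := Finset.card_sdiff_add_card_inter T Q₄
          rw [hTQ, Finset.card_erase_of_mem hv, hQcard, hT.1.2] at this
          show (T \ Q₄).card = ρ - 3
          omega
        · intro T hT T' hT' heq
          rw [Finset.mem_coe, hF, Finset.mem_filter] at hT hT'
          simp only at heq
          have e : ∀ {U : Finset α}, Q₄.erase v ⊆ U → v ∉ U → U = U \ Q₄ ∪ Q₄.erase v := by
            intro U hU hvU
            ext w
            simp only [Finset.mem_union, Finset.mem_sdiff, Finset.mem_erase]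
            constructor
            · intro hw
              by_cases hwQ : w ∈ Q₄
              · exact Or.inr ⟨fun h => hvU (h ▸ hw), hwQ⟩
              · exact Or.inl ⟨hw, hwQ⟩
            · rintro (⟨hw, -⟩ | hw)
              · exact hw
              · exact hU (Finset.mem_erase.2 hw)
          rw [e hT.2.1 hT.2.2, e hT'.2.1 hT'.2.2, heq]
      rw [Finset.card_powersetCard] at h2
      exact h2
    · -- a point of `Q₄ ∖ v` is outside the target: the family is empty
      have : F v = ∅ := by
        rw [Finset.eq_empty_iff_forall_notMem]
        intro T hT
        rw [hF, Finset.mem_filter, Finset.mem_powersetCard] at hT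
        exact hsub (hT.2.1.trans hT.1.1)
      rw [this, Finset.card_empty]
      exact Nat.zero_le _
  -- the pieces in ℕ, by cases on whether the class lies inside the target
  have hmain : (coverBases M G S ρ).card + 0 ≤ 4 * (S'.card - 4).choose (ρ - 3) + (S'.card - 4).choose (ρ - 4) := by
    by_cases hQS : Q₄ ⊆ S'
    · -- all five families, each bounded through `T ↦ T ∖ Q₄`
      have hF₄ : F₄.card ≤ ((S' \ Q₄).card).choose (ρ - 4) := by
        have := card_filter_subset_le S' Q₄ ρ
        rw [hQcard] at this
        exact this
      have hs₄ : (S' \ Q₄).card = S'.card - 4 := by rw [Finset.card_sdiff_of_subset hQS, hQcard]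
      have h1 := Finset.card_le_card hcover
      have h2 := Finset.card_union_le (Q₄.biUnion F) F₄
      have h3 := Finset.card_biUnion_le (s := Q₄) (t := F)
      have h4 : ∑ v ∈ Q₄, (F v).card ≤ ∑ _v ∈ Q₄, ((S' \ Q₄).card).choose (ρ - 3) :=
        Finset.sum_le_sum hcardF
      rw [Finset.sum_const, hQcard, smul_eq_mul] at h4
      have h5 : (coverBases M G S ρ).card ≤ 4 * ((S' \ Q₄).card).choose (ρ - 3) + ((S' \ Q₄).card).choose (ρ - 4) :=
        h1.trans (h2.trans (Nat.add_le_add (h3.trans h4) hF₄))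
      rw [hs₄] at h5
      omega
    · -- a point `w` of the class is outside the target: every covering basis misses exactly `w`
      rw [Finset.not_subset] at hQS
      obtain ⟨w, hwQ, hwS⟩ := hQS
      have hcb : coverBases M G S ρ ⊆ F w := by
        intro T hT
        have hTp : T ∈ S'.powersetCard ρ := by
          unfold coverBases at hT
          exact (Finset.mem_filter.1 hT).1
        have hTS : T ⊆ S' := (Finset.mem_powersetCard.1 hTp).1
        have hwT : w ∉ T := fun h => hwS (hTS h)
        rw [hF, Finset.mem_filter]
        refine ⟨hTp, ?_, hwT⟩
        intro v hv
        rw [Finset.mem_erase] at hv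
        by_contra hvT
        exact hnot T hT w hwQ v hv.2 hv.1.symm hwT hvT
      have h1 := (Finset.card_le_card hcb).trans (hcardF w hwQ)
      by_cases hsub : Q₄.erase w ⊆ S'
      · have hs₄ : (S' \ Q₄).card + 3 = S'.card := by
          have e : S' ∩ Q₄ = Q₄.erase w := by
            ext v
            simp only [Finset.mem_inter, Finset.mem_erase]
            constructor
            · rintro ⟨hvS, hvQ⟩
              exact ⟨fun h => hwS (h ▸ hvS), hvQ⟩
            · rintro ⟨hvw, hvQ⟩
              exact ⟨hsub (Finset.mem_erase.2 ⟨hvw, hvQ⟩), hvQ⟩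
          have := Finset.card_sdiff_add_card_inter S' Q₄
          rw [e, Finset.card_erase_of_mem hwQ, hQcard] at this
          omega
        by_cases hs3 : S'.card ≤ 3
        · have h0 : (S'.card - 3).choose (ρ - 3) = 0 := by
            rw [show S'.card - 3 = 0 by omega]
            exact Nat.choose_eq_zero_of_lt (by omega)
          rw [show (S' \ Q₄).card = S'.card - 3 by omega, h0] at h1
          omega
        · have hp : (S'.card - 3).choose (ρ - 3) = (S'.card - 4).choose (ρ - 4) + (S'.card - 4).choose (ρ - 3) := by
            have e1 : S'.card - 3 = (S'.card - 4) + 1 := by omega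
            have e2 : ρ - 3 = (ρ - 4) + 1 := by omega
            rw [e1, e2]
            exact Nat.choose_succ_succ _ _
          rw [show (S' \ Q₄).card = S'.card - 3 by omega] at h1
          omega
      · have : F w = ∅ := by
          rw [Finset.eq_empty_iff_forall_notMem]
          intro T hT
          rw [hF, Finset.mem_filter, Finset.mem_powersetCard] at hT
          exact hsub (hT.2.1.trans hT.1.1)
        have h0 := Finset.card_le_card hcb
        rw [this, Finset.card_empty] at h0
        omega
  unfold cntK4
  have h5 := (Nat.cast_le (α := ℚ)).2 hmain
  push_cast at h5
  linarith only [h5]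

end PercRepro.Shadow
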